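import Summits.QuantumFields.YangMills.Theses.FradkinShenkerFlow
import Summits.QuantumFields.YangMills.Theorems.FradkinShenkerFlowSusceptibilityToPoincareLinkSetPoincare
import Literature.MathematicalPhysics.QuantumFieldTheory.LatticeGaugeDobrushinPoincare

/-!
# Stub `stub_sparseTerminal` of the line `planted-link-pinning` (crux `SusceptibilityToPoincare`)

Route `FradkinShenkerFlow` of `YangMills`, crux item `stmt-QuantumFields-9441`
(`Summit.QuantumFields.YangMills.Theses.FradkinShenkerFlow.SusceptibilityToPoincare`, FS ⇒ UP).
Helper file (supports the item, closes nothing) proving the registered stub T1 `stub_sparseTerminal`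
of the skeleton `Cruxes/SusceptibilityToPoincare/Lines/planted_link_pinning.lean` (v2): the **sparse
terminal stage on the torus**. For the 4D torus of side `L = 2S+1`, `μ = wilsonMeasure r.ρ β`, the
isolated link families `Φ_{a,i} = {(x, i) | ∀ ν, (x ν − a ν).val odd}` and bounded measurable `F`,
`(L⁴)⁻¹ Σ_i Σ_a ∫ (F − μ[F | links off Φ_{a,i}])² dμ ≤ ½ · ℰ_hb(F)`,
`ℰ_hb(F) = Σ_ℓ ∫∫ (F U − F(U[ℓ ↦ g]))² dν_ℓ^U(g) dμ(U)`, `ν_ℓ^U = Haar.tilted (−β S_W(U[ℓ ↦ ·]))`,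
GIVEN the abstract sparse Efron–Stein inequality T0 for Gibbsian kernels (a hypothesis, as
registered; it is the landed `stub_gibbsSparseEfronStein`).

* *Sparsity* (`SparseTerminal.eq_of_mem_plaquette`): two links of `Φ_{a,i}` on a common plaquette
  have the same direction, hence base points `y`, `y + e_k`; but `v.val` and `(v + 1).val` are
  never both odd in `ZMod (2S+1)` (odd modulus).
* *DLR plumbing* (`SparseTerminal.integral_sub_condExp_sq_le_of_sparse`, that of
  `LinkSetPoincare.integral_sub_condExp_sq_le`): `μ` is a DLR state of the plaquette specification
  (`isGibbsMeasure_wilsonMeasure`), `γ_Λ F` is a version of `μ[F | 𝓕_{Λᶜ}]`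
  (`IsGibbsMeasure.condExp_ae_eq_integral`), conditional variance = averaged kernel variance
  (DLR + properness), T0 inside a kernel, DLR backwards, and `−β H_{{ℓ}}(U[ℓ ↦ ·])` differs from
  `−β S_W(U[ℓ ↦ ·])` by a constant (`dependsOn_hamiltonianIn_sub`, `tilted_const_add_eq`): the
  one-site law IS `ν_ℓ^U`.
* *Bookkeeping*: drop the oddness condition (summands `≥ 0`), `Σ_i Σ_{ℓ.2 = i} = Σ_ℓ`, `#Site = L⁴`.
-/

noncomputable section

open MeasureTheory ProbabilityTheory
open Literature.MathematicalPhysics.QuantumFieldTheory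
open Literature.Probability.LatticeModels
open Literature.MathematicalPhysics.QuantumLattice (exists_plaquettePotential
  isGibbsMeasure_wilsonMeasure dependsOn_integral_gibbsSpecOfPotential)

namespace Summit.QuantumFields.YangMills.Theorems.SusceptibilityToPoincare

namespace SparseTerminal

/-! ### §A  Sparsity of the isolated families with respect to plaquettes -/

section Family

variable {d S : ℕ}

/-- In `ZMod (2S+1)` (odd modulus) the canonical representatives of `v` and `v + 1` are never both
odd: either `(v+1).val = v.val + 1`, or `v.val = 2S` is even. [folklore] -/
theorem not_odd_val_and_odd_val_add_one (v : ZMod (2 * S + 1)) (h1 : Odd v.val)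
    (h2 : Odd (v + 1).val) : False := by
  have hlt : v.val < 2 * S + 1 := ZMod.val_lt v
  rw [Nat.odd_iff] at h1
  rcases Nat.eq_zero_or_pos S with rfl | hS
  · omega
  · have hone : (1 : ZMod (2 * S + 1)).val = 1 := by
      rw [ZMod.val_one_eq_one_mod, Nat.mod_eq_of_lt (by omega)]
    by_cases hc : v.val + 1 < 2 * S + 1
    · rw [ZMod.val_add_of_lt (by rw [hone]; exact hc), hone, Nat.odd_iff] at h2
      omega
    · omega

/-- A site `p` and its unit translate `p + e_k` are never both "odd relative to `a`" in every
coordinate (coordinate `k` changes its representative by one). [folklore] -/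
theorem not_odd_and_odd_shift (a p : Site d (2 * S + 1)) (k : Fin d)
    (ho : ∀ ν, Odd (p ν - a ν).val) (ho' : ∀ ν, Odd (p.shift k ν - a ν).val) : False := by
  refine not_odd_val_and_odd_val_add_one (p k - a k) (ho k) ?_
  have h := ho' k
  simp only [Literature.MathematicalPhysics.QuantumFieldTheory.Site.shift, Pi.add_apply,
    Pi.single_eq_same] at h
  rwa [add_sub_right_comm] at h

/-- Two unit translates `p + e_k`, `p + e_{k'}` of the same site that are both "odd relative to
`a`" in every coordinate have `k = k'`. [folklore] -/
theorem eq_of_odd_shift_of_odd_shift (a p : Site d (2 * S + 1)) {k k' : Fin d}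
    (ho : ∀ ν, Odd (p.shift k ν - a ν).val) (ho' : ∀ ν, Odd (p.shift k' ν - a ν).val) :
    k = k' := by
  by_contra hne
  refine not_odd_val_and_odd_val_add_one (p k' - a k') ?_ ?_
  · have h := ho k'
    simpa only [Literature.MathematicalPhysics.QuantumFieldTheory.Site.shift, Pi.add_apply,
      Pi.single_eq_of_ne (Ne.symm hne), add_zero] using h
  · have h := ho' k'
    simp only [Literature.MathematicalPhysics.QuantumFieldTheory.Site.shift, Pi.add_apply,
      Pi.single_eq_same] at h
    rwa [add_sub_right_comm] at h

/-- **The isolated families are sparse for the plaquette interaction**: two links of the edge set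
`{(y, i), (y + e_i, j), (y + e_j, i), (y, j)}` of a plaquette with the same direction and both base
points odd relative to `a` in every coordinate coincide. [folklore] -/
theorem eq_of_mem_plaquette (a : Site d (2 * S + 1)) {y : Site d (2 * S + 1)} {i j : Fin d}
    {x x' : Edge d (2 * S + 1)}
    (hx : x = (y, i) ∨ x = (y.shift i, j) ∨ x = (y.shift j, i) ∨ x = (y, j))
    (hx' : x' = (y, i) ∨ x' = (y.shift i, j) ∨ x' = (y.shift j, i) ∨ x' = (y, j))
    (hdir : x.2 = x'.2) (ho : ∀ ν, Odd (x.1 ν - a ν).val) (ho' : ∀ ν, Odd (x'.1 ν - a ν).val) :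
    x = x' := by
  have hpos : ∀ {z : Edge d (2 * S + 1)},
      (z = (y, i) ∨ z = (y.shift i, j) ∨ z = (y.shift j, i) ∨ z = (y, j)) →
      z.1 = y ∨ ∃ k, z.1 = y.shift k := by
    rintro z (rfl | rfl | rfl | rfl)
    exacts [Or.inl rfl, Or.inr ⟨i, rfl⟩, Or.inr ⟨j, rfl⟩, Or.inl rfl]
  refine Prod.ext ?_ hdir
  rcases hpos hx with h | ⟨k, h⟩ <;> rcases hpos hx' with h' | ⟨k', h'⟩ <;> rw [h] at ho ⊢ <;>
    rw [h'] at ho' ⊢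
  · exact (not_odd_and_odd_shift a y k' ho ho').elim
  · exact (not_odd_and_odd_shift a y k ho' ho).elim
  · rw [eq_of_odd_shift_of_odd_shift a y ho ho']

end Family

/-! ### §B  Conditional variance given the links off a sparse link set -/

section Torus

variable {G : Type} [Group G] [TopologicalSpace G] [IsTopologicalGroup G] [CompactSpace G]
  [MeasurableSpace G] [BorelSpace G]

/-- **Conditional variance given the links off a SPARSE link set** (no two links of `Λ` on a
common plaquette), for the torus Wilson measure `μ = wilsonMeasure r.ρ β`, GIVEN the abstract
sparse Efron–Stein inequality T0 for Gibbsian kernels: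
`∫ (F − μ[F | 𝓕_{Λᶜ}])² dμ ≤ ½ Σ_{ℓ ∈ Λ} ∫∫ (F U − F(U[ℓ ↦ g]))² dν_ℓ^U(g) dμ(U)`
(DLR state of the plaquette specification, `isGibbsMeasure_wilsonMeasure`; kernel average = version
of the conditional expectation, `IsGibbsMeasure.condExp_ae_eq_integral`; DLR + properness; T0 in
each kernel; DLR backwards; the one-site tilt `−β H_{{ℓ}}(U[ℓ ↦ ·])` is `−β S_W(U[ℓ ↦ ·])` up to a
constant, `dependsOn_hamiltonianIn_sub`). [folklore] -/
theorem integral_sub_condExp_sq_le_of_sparse (r : LatticeRep G) (β : ℝ)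
    (hT0 : ∀ (V : Type) (X : Type) [DecidableEq V] [Countable V] [MeasurableSpace X]
        [MeasurableSingletonClass X] (ν : MeasureTheory.Measure X) [IsProbabilityMeasure ν]
        (Φ : Literature.Probability.LatticeModels.Potential V X) (supp : Finset V → Finset (Finset V))
        (β : ℝ), Φ.IsAdapted → (∀ A, ∃ C : ℝ, ∀ σ, |Φ A σ| ≤ C) → Φ.IsSupportedBy supp →
        ∀ (Λ : Finset V), (∀ A ∈ supp Λ, ∀ x ∈ A, ∀ y ∈ A, x ∈ Λ → y ∈ Λ → x = y) →
        ∀ (η : V → X) (F : (V → X) → ℝ), Measurable F → (∃ M : ℝ, ∀ σ, |F σ| ≤ M) →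
          ∫ σ, (F σ - ∫ τ, F τ
              ∂(Literature.Probability.LatticeModels.gibbsSpecOfPotential ν Φ supp β Λ η)) ^ 2
            ∂(Literature.Probability.LatticeModels.gibbsSpecOfPotential ν Φ supp β Λ η) ≤
          (1 / 2 : ℝ) * ∑ x ∈ Λ, ∫ σ, ∫ y, (F σ - F (Function.update σ x y)) ^ 2
              ∂(ν.tilted fun y' => -β *
                Literature.Probability.LatticeModels.hamiltonianIn Φ supp {x} (Function.update σ x y'))
            ∂(Literature.Probability.LatticeModels.gibbsSpecOfPotential ν Φ supp β Λ η))
    (S : ℕ) {Λ : Finset (Edge 4 (2 * S + 1))}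
    (hΛ : ∀ (y : Site 4 (2 * S + 1)) (i j : Fin 4) (x x' : Edge 4 (2 * S + 1)),
      (x = (y, i) ∨ x = (y.shift i, j) ∨ x = (y.shift j, i) ∨ x = (y, j)) →
      (x' = (y, i) ∨ x' = (y.shift i, j) ∨ x' = (y.shift j, i) ∨ x' = (y, j)) →
      x ∈ Λ → x' ∈ Λ → x = x')
    {F : GaugeConfig 4 (2 * S + 1) G → ℝ} (hF : Measurable F) {M : ℝ} (hM : ∀ U, |F U| ≤ M) :
    ∫ U, (F U - ((wilsonMeasure r.ρ β : Measure (GaugeConfig 4 (2 * S + 1) G))[F|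
        cylinderEvents ((↑Λ : Set (Edge 4 (2 * S + 1)))ᶜ)]) U) ^ 2
        ∂(wilsonMeasure r.ρ β : Measure (GaugeConfig 4 (2 * S + 1) G)) ≤
      (1 / 2 : ℝ) * ∑ ℓ ∈ Λ, ∫ U, ∫ g, (F U - F (Function.update U ℓ g)) ^ 2
          ∂((haarProbability G).tilted (fun g' => -β * wilsonAction r.ρ (Function.update U ℓ g')))
          ∂(wilsonMeasure r.ρ β : Measure (GaugeConfig 4 (2 * S + 1) G)) := by
  haveI : SecondCountableTopology G :=
    (r.continuous.isClosedEmbedding r.injective).isEmbedding.secondCountableTopology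
  haveI : T2Space G := (r.continuous.isClosedEmbedding r.injective).isEmbedding.t2Space
  set μ : Measure (GaugeConfig 4 (2 * S + 1) G) := wilsonMeasure r.ρ β with hμdef
  haveI : IsProbabilityMeasure μ :=
    isProbabilityMeasure_wilsonMeasure (d := 4) (L := 2 * S + 1) r.ρ r.continuous β
  -- the heat-bath resampling costs `Ψ ℓ U = ∫ (F U − F(U[ℓ ↦ g]))² dν_ℓ^U(g)`
  set Ψ : Edge 4 (2 * S + 1) → GaugeConfig 4 (2 * S + 1) G → ℝ := fun ℓ U =>
    ∫ g, (F U - F (Function.update U ℓ g)) ^ 2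
      ∂((haarProbability G).tilted (fun g' => -β * wilsonAction r.ρ (Function.update U ℓ g')))
    with hΨ
  -- the Gibbs structure of `μ`
  obtain ⟨Φ, supp, hΦ, hΦb, hsupp, hH, hstruct⟩ :=
    exists_plaquettePotential (d := 4) (L := 2 * S + 1) r.ρ r.continuous
  set γ : Specification (Edge 4 (2 * S + 1)) G :=
    gibbsSpecOfPotential (haarProbability G) Φ supp β with hγdef
  have hγ : IsSpecification γ :=
    isSpecification_gibbsSpecOfPotential (haarProbability G) hΦ hΦb hsupp β
  have hGibbs : IsGibbsMeasure γ μ :=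
    isGibbsMeasure_wilsonMeasure r.ρ r.continuous hΦ hΦb hsupp hH β
  haveI hγprob : ∀ η, IsProbabilityMeasure (γ Λ η) := fun η => hγ.isProbability Λ η
  let κk : Kernel (GaugeConfig 4 (2 * S + 1) G) (GaugeConfig 4 (2 * S + 1) G) :=
    ⟨γ Λ, hγ.measurable_fun Λ⟩
  -- sparsity of `Λ` with respect to the interaction sets (edge sets of plaquettes)
  have hΛs : ∀ A ∈ supp Λ, ∀ x ∈ A, ∀ y ∈ A, x ∈ Λ → y ∈ Λ → x = y := by
    intro A hA x hx x' hx' hxΛ hx'Λ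
    obtain ⟨y, i, j, -, rfl⟩ := hstruct Λ A hA
    simp only [Finset.mem_insert, Finset.mem_singleton] at hx hx'
    exact hΛ y i j x x' hx hx' hxΛ hx'Λ
  -- the one-site tilt of the specification at a link is the heat-bath law
  have htilt : ∀ (U : GaugeConfig 4 (2 * S + 1) G) (ℓ : Edge 4 (2 * S + 1)),
      (haarProbability G).tilted
          (fun g' => -β * hamiltonianIn Φ supp {ℓ} (Function.update U ℓ g')) =
        (haarProbability G).tilted (fun g' => -β * wilsonAction r.ρ (Function.update U ℓ g')) := by
    intro U ℓ
    have hc : ∀ g', hamiltonianIn Φ supp Finset.univ (Function.update U ℓ g') -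
        hamiltonianIn Φ supp {ℓ} (Function.update U ℓ g') =
        hamiltonianIn Φ supp Finset.univ U - hamiltonianIn Φ supp {ℓ} U := fun g' =>
      dependsOn_hamiltonianIn_sub hΦ hsupp (Finset.subset_univ {ℓ}) fun e he =>
        Function.update_of_ne (fun h => he (Finset.mem_coe.2 (Finset.mem_singleton.2 h))) g' U
    have hfun : (fun g' => -β * hamiltonianIn Φ supp {ℓ} (Function.update U ℓ g')) = fun g' =>
        β * (hamiltonianIn Φ supp Finset.univ U - hamiltonianIn Φ supp {ℓ} U) +
          -β * wilsonAction r.ρ (Function.update U ℓ g') := by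
      funext g'
      rw [← hH (Function.update U ℓ g'), ← hc g']
      ring
    rw [hfun]
    exact tilted_const_add_eq (haarProbability G) _ _
  -- the kernel average `mF` of `F`: a version of the conditional expectation, local, bounded
  set mF : GaugeConfig 4 (2 * S + 1) G → ℝ := fun η => ∫ σ, F σ ∂(γ Λ η) with hmF
  have hcond : μ[F|cylinderEvents (X := fun _ : Edge 4 (2 * S + 1) => G)
      ((↑Λ : Set (Edge 4 (2 * S + 1)))ᶜ)] =ᵐ[μ] mF :=
    hGibbs.condExp_ae_eq_integral hγ Λ hF hM
  have hmFm : Measurable mF := (hF.stronglyMeasurable.integral_kernel (κ := κk)).measurable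
  have hmFb : ∀ η, |mF η| ≤ M := fun η => by
    have := norm_integral_le_of_norm_le_const (μ := γ Λ η) (C := M) (f := F)
      (ae_of_all _ fun σ => by rw [Real.norm_eq_abs]; exact hM σ)
    simpa only [Real.norm_eq_abs, probReal_univ, mul_one] using this
  have hmFdep : DependsOn mF ((↑Λ : Set (Edge 4 (2 * S + 1)))ᶜ) :=
    dependsOn_integral_gibbsSpecOfPotential (haarProbability G) hΦ supp β Λ
      (T := ((↑Λ : Set (Edge 4 (2 * S + 1)))ᶜ))
      (fun A _ _ => by rw [Set.union_compl_self]; exact Set.subset_univ _)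
      hF.stronglyMeasurable (by rw [Set.union_compl_self]; exact dependsOn_univ F)
  -- measurability and boundedness of the heat-bath costs
  have hΨm : ∀ ℓ, Measurable (Ψ ℓ) := fun ℓ =>
    HaarResample.measurable_integral_tilted
      (measurable_const.mul ((measurable_wilsonAction r.ρ r.continuous).comp measurable_update'))
      (((hF.comp measurable_fst).sub (hF.comp measurable_update')).pow_const 2)
  have hΨ0 : ∀ ℓ σ, 0 ≤ Ψ ℓ σ := fun ℓ σ => integral_nonneg fun _ => sq_nonneg _
  have hΨB : ∀ ℓ σ, Ψ ℓ σ ≤ (2 * M) ^ 2 := fun ℓ σ => by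
    have h := norm_integral_le_of_norm_le_const (μ := (haarProbability G).tilted
      (fun g' => -β * wilsonAction r.ρ (Function.update σ ℓ g')))
      (ae_of_all _ fun g => OrbitES.norm_sq_sub_le (hM σ) (hM (Function.update σ ℓ g)))
    rw [Real.norm_eq_abs, abs_of_nonneg (hΨ0 ℓ σ)] at h
    exact h.trans (mul_le_of_le_one_right (sq_nonneg _) measureReal_le_one)
  have hΨint : ∀ ℓ, Integrable (Ψ ℓ) μ := fun ℓ =>
    Integrable.of_bound (hΨm ℓ).aestronglyMeasurable ((2 * M) ^ 2)
      (ae_of_all _ fun σ => by rw [Real.norm_eq_abs, abs_of_nonneg (hΨ0 ℓ σ)]; exact hΨB ℓ σ)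
  have hΨki : ∀ ℓ, Integrable (fun η => ∫ σ, Ψ ℓ σ ∂(γ Λ η)) μ := fun ℓ =>
    Integrable.of_bound ((hΨm ℓ).stronglyMeasurable.integral_kernel (κ := κk)).aestronglyMeasurable
      ((2 * M) ^ 2) (ae_of_all _ fun η => by
        have := norm_integral_le_of_norm_le_const (μ := γ Λ η) (C := (2 * M) ^ 2) (f := Ψ ℓ)
          (ae_of_all _ fun σ => by rw [Real.norm_eq_abs, abs_of_nonneg (hΨ0 ℓ σ)]; exact hΨB ℓ σ)
        simpa only [probReal_univ, mul_one] using this)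
  -- STEP 2 (inside one kernel): the sparse Efron–Stein inequality T0
  have hker : ∀ η, ∫ σ, (F σ - mF η) ^ 2 ∂(γ Λ η) ≤
      (1 / 2 : ℝ) * ∑ ℓ ∈ Λ, ∫ σ, Ψ ℓ σ ∂(γ Λ η) := fun η => by
    have h := hT0 (Edge 4 (2 * S + 1)) G (haarProbability G) Φ supp β hΦ hΦb hsupp Λ hΛs η F hF
      ⟨M, hM⟩
    simp only [htilt] at h
    exact h
  -- STEP 1 (conditional variance = averaged kernel variance) and STEP 3 (DLR backwards)
  have hinner : ∀ η, ∫ σ, (F σ - mF σ) ^ 2 ∂(γ Λ η) = ∫ σ, (F σ - mF η) ^ 2 ∂(γ Λ η) :=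
    fun η => by
      refine integral_congr_ae ?_
      filter_upwards [hγ.proper Λ η] with σ hσ
      rw [hmFdep (fun e he => hσ e (fun h => he (Finset.mem_coe.2 h)))]
  have hint1 : Integrable (fun σ => (F σ - mF σ) ^ 2) μ :=
    Integrable.of_bound ((hF.sub hmFm).pow_const 2).aestronglyMeasurable ((2 * M) ^ 2)
      (ae_of_all _ fun σ => OrbitES.norm_sq_sub_le (hM σ) (hmFb σ))
  have hRi : Integrable (fun η => (1 / 2 : ℝ) * ∑ ℓ ∈ Λ, ∫ σ, Ψ ℓ σ ∂(γ Λ η)) μ :=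
    (integrable_finsetSum _ fun ℓ _ => hΨki ℓ).const_mul _
  calc ∫ U, (F U - (μ[F|cylinderEvents (X := fun _ : Edge 4 (2 * S + 1) => G)
          ((↑Λ : Set (Edge 4 (2 * S + 1)))ᶜ)]) U) ^ 2 ∂μ
      = ∫ U, (F U - mF U) ^ 2 ∂μ :=
        integral_congr_ae (by filter_upwards [hcond] with U hU; rw [hU])
    _ = ∫ η, ∫ σ, (F σ - mF σ) ^ 2 ∂(γ Λ η) ∂μ := (hGibbs.integral_integral_eq hγ Λ hint1).symm
    _ = ∫ η, ∫ σ, (F σ - mF η) ^ 2 ∂(γ Λ η) ∂μ := integral_congr_ae (ae_of_all _ hinner)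
    _ ≤ ∫ η, (1 / 2 : ℝ) * ∑ ℓ ∈ Λ, ∫ σ, Ψ ℓ σ ∂(γ Λ η) ∂μ :=
        integral_mono_of_nonneg (ae_of_all _ fun η => integral_nonneg fun _ => sq_nonneg _) hRi
          (ae_of_all _ hker)
    _ = (1 / 2 : ℝ) * ∑ ℓ ∈ Λ, ∫ η, ∫ σ, Ψ ℓ σ ∂(γ Λ η) ∂μ := by
        rw [integral_const_mul, integral_finsetSum _ fun ℓ _ => hΨki ℓ]
    _ = (1 / 2 : ℝ) * ∑ ℓ ∈ Λ, ∫ σ, Ψ ℓ σ ∂μ := by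
        congr 1
        exact Finset.sum_congr rfl fun ℓ _ => hGibbs.integral_integral_eq hγ Λ (hΨint ℓ)

/-- **Conditional variance given the links off the isolated family `Φ_{a,i}`**, GIVEN T0:
`∫ (F − μ[F | links off Φ_{a,i}])² dμ ≤ ½ Σ_{ℓ : ℓ.2 = i} ∫∫ (F U − F(U[ℓ ↦ g]))² dν_ℓ^U(g) dμ(U)`,
`Φ_{a,i} = {(x, i) | ∀ ν, (x ν − a ν).val odd}` being sparse for the plaquette interaction
(`eq_of_mem_plaquette`) and every summand being nonnegative. [folklore] -/
theorem integral_sub_condExp_sq_family_le (r : LatticeRep G) (β : ℝ)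
    (hT0 : ∀ (V : Type) (X : Type) [DecidableEq V] [Countable V] [MeasurableSpace X]
        [MeasurableSingletonClass X] (ν : MeasureTheory.Measure X) [IsProbabilityMeasure ν]
        (Φ : Literature.Probability.LatticeModels.Potential V X) (supp : Finset V → Finset (Finset V))
        (β : ℝ), Φ.IsAdapted → (∀ A, ∃ C : ℝ, ∀ σ, |Φ A σ| ≤ C) → Φ.IsSupportedBy supp →
        ∀ (Λ : Finset V), (∀ A ∈ supp Λ, ∀ x ∈ A, ∀ y ∈ A, x ∈ Λ → y ∈ Λ → x = y) →
        ∀ (η : V → X) (F : (V → X) → ℝ), Measurable F → (∃ M : ℝ, ∀ σ, |F σ| ≤ M) →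
          ∫ σ, (F σ - ∫ τ, F τ
              ∂(Literature.Probability.LatticeModels.gibbsSpecOfPotential ν Φ supp β Λ η)) ^ 2
            ∂(Literature.Probability.LatticeModels.gibbsSpecOfPotential ν Φ supp β Λ η) ≤
          (1 / 2 : ℝ) * ∑ x ∈ Λ, ∫ σ, ∫ y, (F σ - F (Function.update σ x y)) ^ 2
              ∂(ν.tilted fun y' => -β *
                Literature.Probability.LatticeModels.hamiltonianIn Φ supp {x} (Function.update σ x y'))
            ∂(Literature.Probability.LatticeModels.gibbsSpecOfPotential ν Φ supp β Λ η))
    (S : ℕ) (i : Fin 4) (a : Site 4 (2 * S + 1))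
    {F : GaugeConfig 4 (2 * S + 1) G → ℝ} (hF : Measurable F) {M : ℝ} (hM : ∀ U, |F U| ≤ M) :
    ∫ U, (F U - ((wilsonMeasure r.ρ β : Measure (GaugeConfig 4 (2 * S + 1) G))[F|
        cylinderEvents (X := fun _ : Edge 4 (2 * S + 1) => G)
          {ℓ : Edge 4 (2 * S + 1) | ℓ.2 = i ∧ ∀ ν, Odd (ℓ.1 ν - a ν).val}ᶜ]) U) ^ 2
        ∂(wilsonMeasure r.ρ β : Measure (GaugeConfig 4 (2 * S + 1) G)) ≤
      (1 / 2 : ℝ) * ∑ ℓ : Edge 4 (2 * S + 1) with ℓ.2 = i,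
        ∫ U, ∫ g, (F U - F (Function.update U ℓ g)) ^ 2
          ∂((haarProbability G).tilted (fun g' => -β * wilsonAction r.ρ (Function.update U ℓ g')))
          ∂(wilsonMeasure r.ρ β : Measure (GaugeConfig 4 (2 * S + 1) G)) := by
  classical
  set Λ : Finset (Edge 4 (2 * S + 1)) :=
    Finset.univ.filter (fun ℓ => ℓ.2 = i ∧ ∀ ν, Odd (ℓ.1 ν - a ν).val) with hΛdef
  have hset : {ℓ : Edge 4 (2 * S + 1) | ℓ.2 = i ∧ ∀ ν, Odd (ℓ.1 ν - a ν).val} =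
      (↑Λ : Set (Edge 4 (2 * S + 1))) := by
    ext ℓ
    simp [hΛdef]
  rw [hset]
  have hΛ : ∀ (y : Site 4 (2 * S + 1)) (i' j : Fin 4) (x x' : Edge 4 (2 * S + 1)),
      (x = (y, i') ∨ x = (y.shift i', j) ∨ x = (y.shift j, i') ∨ x = (y, j)) →
      (x' = (y, i') ∨ x' = (y.shift i', j) ∨ x' = (y.shift j, i') ∨ x' = (y, j)) →
      x ∈ Λ → x' ∈ Λ → x = x' := by
    intro y i' j x x' hx hx' hxΛ hx'Λ
    simp only [hΛdef, Finset.mem_filter, Finset.mem_univ, true_and] at hxΛ hx'Λ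
    exact eq_of_mem_plaquette a hx hx' (hxΛ.1.trans hx'Λ.1.symm) hxΛ.2 hx'Λ.2
  refine (integral_sub_condExp_sq_le_of_sparse r β hT0 S hΛ hF hM).trans ?_
  refine mul_le_mul_of_nonneg_left (Finset.sum_le_sum_of_subset_of_nonneg (fun ℓ hℓ => ?_)
    fun ℓ _ _ => integral_nonneg fun U => integral_nonneg fun g => sq_nonneg _) (by norm_num)
  simp only [hΛdef, Finset.mem_filter, Finset.mem_univ, true_and] at hℓ ⊢
  exact hℓ.1

end Torus

end SparseTerminal

/-! ### The registered stub -/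

/-- `stub_sparseTerminal` — **T1 · sparse terminal stage on the torus** (registered stub of the
line `planted-link-pinning`, v2; TRUE for every compact `G`, every lattice representation `r`,
every real `β`). IF the abstract sparse Efron–Stein inequality T0 for Gibbsian kernels holds, THEN
with `C = ½`, for all `S` and all bounded measurable `F` on the torus of side `L = 2S+1`,
`(L⁴)⁻¹ Σ_{i : Fin 4} Σ_{a} ∫ (F − μ[F | links off Φ_{a,i}])² dμ ≤ C · ℰ_hb(F)`,
`Φ_{a,i} = {(x,i) | ∀ ν, (x ν − a ν).val odd}`, `μ = wilsonMeasure r.ρ β`,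
`ℰ_hb(F) = Σ_ℓ ∫∫ (F U − F(U[ℓ ↦ g]))² dν_ℓ^U(g) dμ(U)` with the one-link heat-bath laws
`ν_ℓ^U = Haar.tilted (−β S_W(U[ℓ ↦ ·]))`. Per family: DLR plumbing + T0 + identification of the
one-site tilt with the heat-bath law (`SparseTerminal.integral_sub_condExp_sq_family_le`); then
drop the oddness condition, `Σ_i Σ_{ℓ.2 = i} = Σ_ℓ`, `#Site = L⁴`. [folklore] -/
theorem stub_sparseTerminal :
    ∀ (G : Type) [Group G] [TopologicalSpace G] [IsTopologicalGroup G] [CompactSpace G]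
      [MeasurableSpace G] [BorelSpace G],
      ∀ (r : Literature.MathematicalPhysics.QuantumFieldTheory.LatticeRep G) (β : ℝ),
      (∀ (V : Type) (X : Type) [DecidableEq V] [Countable V] [MeasurableSpace X]
        [MeasurableSingletonClass X] (ν : MeasureTheory.Measure X) [IsProbabilityMeasure ν]
        (Φ : Literature.Probability.LatticeModels.Potential V X) (supp : Finset V → Finset (Finset V))
        (β : ℝ), Φ.IsAdapted → (∀ A, ∃ C : ℝ, ∀ σ, |Φ A σ| ≤ C) → Φ.IsSupportedBy supp →
        ∀ (Λ : Finset V), (∀ A ∈ supp Λ, ∀ x ∈ A, ∀ y ∈ A, x ∈ Λ → y ∈ Λ → x = y) →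
        ∀ (η : V → X) (F : (V → X) → ℝ), Measurable F → (∃ M : ℝ, ∀ σ, |F σ| ≤ M) →
          ∫ σ, (F σ - ∫ τ, F τ
              ∂(Literature.Probability.LatticeModels.gibbsSpecOfPotential ν Φ supp β Λ η)) ^ 2
            ∂(Literature.Probability.LatticeModels.gibbsSpecOfPotential ν Φ supp β Λ η) ≤
          (1 / 2 : ℝ) * ∑ x ∈ Λ, ∫ σ, ∫ y, (F σ - F (Function.update σ x y)) ^ 2
              ∂(ν.tilted fun y' => -β *
                Literature.Probability.LatticeModels.hamiltonianIn Φ supp {x} (Function.update σ x y'))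
            ∂(Literature.Probability.LatticeModels.gibbsSpecOfPotential ν Φ supp β Λ η)) →
      ∃ C : ℝ, 0 ≤ C ∧ ∀ (S : ℕ)
        (F : Literature.MathematicalPhysics.QuantumFieldTheory.GaugeConfig 4 (2 * S + 1) G → ℝ),
        Measurable F → (∃ M : ℝ, ∀ U, |F U| ≤ M) →
          (((2 * S + 1) ^ 4 : ℕ) : ℝ)⁻¹ *
            ∑ i : Fin 4, ∑ a : Literature.MathematicalPhysics.QuantumFieldTheory.Site 4 (2 * S + 1),
              ∫ U, (F U - ((Literature.MathematicalPhysics.QuantumFieldTheory.wilsonMeasure (d := 4)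
                  (L := 2 * S + 1) r.ρ β)[F | MeasureTheory.cylinderEvents
                    (X := fun _ : Literature.MathematicalPhysics.QuantumFieldTheory.Edge 4 (2 * S + 1) => G)
                    {ℓ : Literature.MathematicalPhysics.QuantumFieldTheory.Edge 4 (2 * S + 1) |
                      ℓ.2 = i ∧ ∀ ν, Odd (ℓ.1 ν - a ν).val}ᶜ]) U) ^ 2
                ∂(Literature.MathematicalPhysics.QuantumFieldTheory.wilsonMeasure (d := 4)
                  (L := 2 * S + 1) r.ρ β) ≤
          C * ∑ ℓ : Literature.MathematicalPhysics.QuantumFieldTheory.Edge 4 (2 * S + 1),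
            ∫ U, ∫ g, (F U - F (Function.update U ℓ g)) ^ 2
              ∂((Literature.MathematicalPhysics.QuantumFieldTheory.haarProbability G).tilted
                (fun g' => -β * Literature.MathematicalPhysics.QuantumFieldTheory.wilsonAction
                  r.ρ (Function.update U ℓ g')))
              ∂(Literature.MathematicalPhysics.QuantumFieldTheory.wilsonMeasure (d := 4)
                (L := 2 * S + 1) r.ρ β) := by
  intro G _ _ _ _ _ _ r β hT0
  refine ⟨1 / 2, by norm_num, fun S F hF hbd => ?_⟩
  obtain ⟨M, hM⟩ := hbd
  have hcard : Fintype.card (Site 4 (2 * S + 1)) = (2 * S + 1) ^ 4 := by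
    simp [Fintype.card_pi, ZMod.card]
  have hpos : (0 : ℝ) < (((2 * S + 1) ^ 4 : ℕ) : ℝ) := by positivity
  refine le_trans (mul_le_mul_of_nonneg_left (Finset.sum_le_sum fun i _ =>
    Finset.sum_le_sum fun a _ =>
      SparseTerminal.integral_sub_condExp_sq_family_le r β hT0 S i a hF hM)
        (inv_nonneg.2 hpos.le)) (le_of_eq ?_)
  -- bookkeeping: `Σ_i Σ_a ½ Σ_{ℓ.2 = i} e_ℓ = L⁴ · ½ · Σ_ℓ e_ℓ`
  simp only [Finset.sum_const, Finset.card_univ, nsmul_eq_mul, hcard]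
  rw [← Finset.mul_sum, ← Finset.mul_sum, Finset.sum_fiberwise Finset.univ Prod.snd, ← mul_assoc,
    inv_mul_cancel₀ hpos.ne', one_mul]
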